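import Mathlib
import HarnessLib
import Summits.HubbardSuperconductivity.HubbardSuperconductivity.Theorems.KLProgrammeFermiSurfaceSharpEnvelope
/-!
# Route `KLProgramme` (K1 `H10TwoPointLimit`, K3 `KLRegimeTwoPointLimit`) — sharp band-curve envelopes, part 3:
# convexity, acceleration and the Gauss-map rate on one level curve

Cell `gate-hubbard-kl`, seat fs-1 (g4), risk r2 (serving r1). Continuation of
`KLProgrammeFermiSurfaceSharpEnvelope.lean` (notation as there; `H = cos x·x'² + cos y·y'²` the convexity form,
`α' = bandNormalAngleDeriv` the Gauss-map rate, `κ_min(μ) = -μ/√(32 - 2μ²)` the nodal curvature of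
`KLProgrammeFermiSurfaceEnvelope`). At a level `-4 < μ < 0`, for every angle:

* `c² H = m (1 - cos x cos y)`; **`H ≤ K_μ²`** (attained at the antinodes); **`H · (sin d_μ/d_μ)² ≥ m (1 - m²/4)`**,
  i.e. `H ≥ m d_μ²` (attained at the nodes) — the generic `hmin` of the tree divided by the SHARP `c_max²`;
* `x y'' - y x'' = 2 u u'`, the solved accelerations `W x'' = -(x H + 2uu' sin y)`, `W y'' = 2uu' sin x - y H`
  (`W = c u²`), and **`|x''|, |y''| ≤ √2 (K_μ²/s_μ + 2K_μ)`** (truth: `K_μ²/s_μ` at the antinodes);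
* **`α' ≥ κ_min(μ) · u ≥ κ_min(μ) · √2 · d_μ`** (attained at the nodes: `α' = κ |p'|`).

The closed-form RANGE bundle and the window numbers are in `KLProgrammeFermiSurfaceSharpBandBounds.lean`; certified
numerics (kit job j252652) in FS-WINDOW.md §6. No definitions; everything PROVED. [folklore]
-/

noncomputable section

open Real Set

-- the tree's namespace `Summit.<Summit>.<Problem>.Theorems` repeats the summit name by design (D-0017)
set_option linter.dupNamespace false

namespace Summit.HubbardSuperconductivity.HubbardSuperconductivity.Theorems

open Literature.MathematicalPhysics.QuantumLattice
open Literature.MathematicalPhysics.QuantumLattice.BandSectorCounting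

/-! ### §1 (continued) Second-order envelopes on one level curve -/

section Level

variable {μ : ℝ} (hμ₁ : -4 < μ) (hμ₂ : μ < 0)
include hμ₁ hμ₂

/-- `c² H = cos x sin² y + cos y sin² x = m (1 - cos x cos y)` (`m = -μ/2`). [folklore] -/
theorem klfs_coeff_sq_mul_hess_eq (θ : ℝ) :
    bandNormalCoeff μ θ ^ 2 * (Real.cos (bandX μ θ) * bandVX μ θ ^ 2 + Real.cos (bandY μ θ) * bandVY μ θ ^ 2) =
      (-μ / 2) * (1 - Real.cos (bandX μ θ) * Real.cos (bandY μ θ)) := by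
  have hsx := sin_bandX_eq hμ₁ hμ₂ θ
  have hsy := sin_bandY_eq hμ₁ hμ₂ θ
  have key : bandNormalCoeff μ θ ^ 2 * (Real.cos (bandX μ θ) * bandVX μ θ ^ 2 + Real.cos (bandY μ θ) * bandVY μ θ ^ 2) =
      Real.cos (bandX μ θ) * Real.sin (bandY μ θ) ^ 2 + Real.cos (bandY μ θ) * Real.sin (bandX μ θ) ^ 2 := by
    rw [hsx, hsy]; ring
  rw [key, Real.sin_sq, Real.sin_sq]
  have hlev := klfs_cos_bandX_add_cos_bandY hμ₁ hμ₂ θ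
  have : Real.cos (bandY μ θ) = -μ / 2 - Real.cos (bandX μ θ) := by linarith
  rw [this]; ring

/-- **`H ≤ K_μ²`** (attained at the antinodes, where `x' = 0`, `y' = u = K_μ`): `c² H = m(1 - cos x cos y)`,
`cos x cos y ≥ m - 1`, `c ≥ sin K_μ/K_μ` and `sin² K_μ = m (2 - m)`. [folklore] -/
theorem klfs_hess_le_umklappRadius_sq (θ : ℝ) :
    Real.cos (bandX μ θ) * bandVX μ θ ^ 2 + Real.cos (bandY μ θ) * bandVY μ θ ^ 2 ≤ umklappRadius μ ^ 2 := by
  have hc := bandNormalCoeff_pos hμ₁ hμ₂ θ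
  have hH := bandHess_pos hμ₁ hμ₂ θ
  have hN := klfs_coeff_sq_mul_hess_eq hμ₁ hμ₂ θ
  have hlev := klfs_cos_bandX_add_cos_bandY hμ₁ hμ₂ θ
  have hP := klfs_sub_one_le_mul (Real.cos_le_one (bandX μ θ)) (Real.cos_le_one (bandY μ θ)) hlev
  have hK0 : 0 < umklappRadius μ := umklappRadius_pos hμ₁
  have hsinK : Real.sin (umklappRadius μ) = Real.sqrt (-μ * (4 + μ)) / 2 := klfs_sin_umklappRadius hμ₁.le hμ₂.le
  have hsinK2 : Real.sin (umklappRadius μ) ^ 2 = (-μ / 2) * (2 - -μ / 2) := by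
    rw [hsinK, div_pow, Real.sq_sqrt (by nlinarith)]; ring
  have hq := klfs_sinc_umklappRadius_le_bandNormalCoeff hμ₁ hμ₂ θ
  rw [div_le_iff₀ hK0] at hq
  -- `c² H ≤ m (2 - m) = sin² K ≤ (c K)²`
  have h1 : bandNormalCoeff μ θ ^ 2 * (Real.cos (bandX μ θ) * bandVX μ θ ^ 2 + Real.cos (bandY μ θ) * bandVY μ θ ^ 2) ≤
      Real.sin (umklappRadius μ) ^ 2 := by
    rw [hN, hsinK2]; nlinarith
  have hs0 : 0 ≤ Real.sin (umklappRadius μ) := by rw [hsinK]; positivity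
  have h2 : Real.sin (umklappRadius μ) ^ 2 ≤ (bandNormalCoeff μ θ * umklappRadius μ) ^ 2 :=
    pow_le_pow_left₀ hs0 hq 2
  have hc2 : 0 < bandNormalCoeff μ θ ^ 2 := by positivity
  nlinarith [h1, h2]

/-- **Convexity with the sharp constant**: `H · (sin d_μ/d_μ)² ≥ (-μ/2)(1 - μ²/16)`, i.e.
`H ≥ m (1 - m²/4) d_μ²/sin² d_μ = m d_μ²` — attained at the nodes (`x' = -d`, `y' = d`). [folklore] -/
theorem klfs_hess_mul_sinc_sq_ge (θ : ℝ) :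
    (-μ / 2) * (1 - μ ^ 2 / 16) ≤
      (Real.cos (bandX μ θ) * bandVX μ θ ^ 2 + Real.cos (bandY μ θ) * bandVY μ θ ^ 2) *
        (Real.sin (Real.arccos (-μ / 4)) / Real.arccos (-μ / 4)) ^ 2 := by
  have h := bandNormalCoeff_sq_mul_bandHess_ge hμ₁ hμ₂ θ
  have hH := bandHess_pos hμ₁ hμ₂ θ
  have hc := bandNormalCoeff_pos hμ₁ hμ₂ θ
  have hcs := klfs_bandNormalCoeff_le_sinc hμ₁ hμ₂ θ
  have h2 : bandNormalCoeff μ θ ^ 2 ≤ (Real.sin (Real.arccos (-μ / 4)) / Real.arccos (-μ / 4)) ^ 2 :=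
    pow_le_pow_left₀ hc.le hcs 2
  calc (-μ / 2) * (1 - μ ^ 2 / 16) ≤ _ := h
    _ ≤ _ := by rw [mul_comm]; exact mul_le_mul_of_nonneg_left h2 hH.le

omit hμ₁ hμ₂ in
/-- `x y'' - y x'' = 2 u u'` (the derivative of `x y' - y x' = u²`; pure algebra in the polar frame). [folklore] -/
theorem klfs_bandX_mul_bandAY_sub (θ : ℝ) :
    bandX μ θ * bandAY μ θ - bandY μ θ * bandAX μ θ = 2 * bandFermiRadius μ θ * bandFermiRadiusDeriv μ θ := by
  have hsc := Real.sin_sq_add_cos_sq θ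
  simp only [bandX, bandY, bandAX, bandAY]
  linear_combination (2 * bandFermiRadius μ θ * bandFermiRadiusDeriv μ θ) * hsc

/-- **The acceleration solved**: `(x sin x + y sin y) · x'' = -(x H + 2 u u' sin y)`. [folklore] -/
theorem klfs_W_mul_bandAX (θ : ℝ) :
    (bandX μ θ * Real.sin (bandX μ θ) + bandY μ θ * Real.sin (bandY μ θ)) * bandAX μ θ =
      -(bandX μ θ * (Real.cos (bandX μ θ) * bandVX μ θ ^ 2 + Real.cos (bandY μ θ) * bandVY μ θ ^ 2) +
        2 * bandFermiRadius μ θ * bandFermiRadiusDeriv μ θ * Real.sin (bandY μ θ)) := by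
  have hE := bandHess_add_grad_dot_acc hμ₁ hμ₂ θ
  have hR := klfs_bandX_mul_bandAY_sub (μ := μ) θ
  linear_combination (bandX μ θ) * hE - (Real.sin (bandY μ θ)) * hR

/-- `(x sin x + y sin y) · y'' = 2 u u' sin x - y H`. [folklore] -/
theorem klfs_W_mul_bandAY (θ : ℝ) :
    (bandX μ θ * Real.sin (bandX μ θ) + bandY μ θ * Real.sin (bandY μ θ)) * bandAY μ θ =
      2 * bandFermiRadius μ θ * bandFermiRadiusDeriv μ θ * Real.sin (bandX μ θ) -
        bandY μ θ * (Real.cos (bandX μ θ) * bandVX μ θ ^ 2 + Real.cos (bandY μ θ) * bandVY μ θ ^ 2) := by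
  have hE := bandHess_add_grad_dot_acc hμ₁ hμ₂ θ
  have hR := klfs_bandX_mul_bandAY_sub (μ := μ) θ
  linear_combination (bandY μ θ) * hE + (Real.sin (bandX μ θ)) * hR

/-- **Acceleration envelope**: `|x''| ≤ √2 (K_μ²/s_μ + 2 K_μ)`, `s_μ = √(-μ(4+μ))/2` — from
`W |x''| ≤ |x| H + 2 u |u'| |sin y| ≤ u K_μ² + 2 u² ρ` and `W = c u² ≥ u ρ/√2`, `ρ ≥ s_μ`, `u ≤ K_μ`
(truth: `K_μ²/s_μ`, at the antinodes). [folklore] -/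
theorem klfs_abs_bandAX_le (θ : ℝ) :
    |bandAX μ θ| ≤ Real.sqrt 2 * (umklappRadius μ ^ 2 / (Real.sqrt (-μ * (4 + μ)) / 2) + 2 * umklappRadius μ) := by
  have hu := bandFermiRadius_pos hμ₁ hμ₂ θ
  have hc := bandNormalCoeff_pos hμ₁ hμ₂ θ
  have hH := bandHess_pos hμ₁ hμ₂ θ
  have hHK := klfs_hess_le_umklappRadius_sq hμ₁ hμ₂ θ
  have huK := klfs_bandFermiRadius_le_umklappRadius hμ₁ hμ₂ θ
  have hud := klfs_abs_radiusDeriv_le hμ₁ hμ₂ θ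
  have hW := klfs_W_eq hμ₁ hμ₂ θ
  have hsol := klfs_W_mul_bandAX hμ₁ hμ₂ θ
  have hs0 : 0 < Real.sqrt (-μ * (4 + μ)) / 2 := by
    have : 0 < -μ * (4 + μ) := by nlinarith
    positivity
  have hρs := klfs_levelSin_le_rho hμ₁ hμ₂ θ
  have hρ0 : 0 < Real.sqrt (Real.sin (bandX μ θ) ^ 2 + Real.sin (bandY μ θ) ^ 2) := hs0.trans_le hρs
  have hρW := klfs_rho_le_sqrt_two_mul_coeff_mul_radius hμ₁ hμ₂ θ
  have hx : |bandX μ θ| ≤ bandFermiRadius μ θ := by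
    rw [bandX, abs_mul, abs_of_pos hu]
    exact mul_le_of_le_one_right hu.le (Real.abs_cos_le_one θ)
  have hsy : |Real.sin (bandY μ θ)| ≤ Real.sqrt (Real.sin (bandX μ θ) ^ 2 + Real.sin (bandY μ θ) ^ 2) := by
    rw [← Real.sqrt_sq_eq_abs]; exact Real.sqrt_le_sqrt (by nlinarith [sq_nonneg (Real.sin (bandX μ θ))])
  refine klfs_accel_aux hu hρ0 hs0 hρs huK ?_ ?_ (W := bandNormalCoeff μ θ * bandFermiRadius μ θ ^ 2)
  · calc bandFermiRadius μ θ * Real.sqrt (Real.sin (bandX μ θ) ^ 2 + Real.sin (bandY μ θ) ^ 2)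
        ≤ bandFermiRadius μ θ * (Real.sqrt 2 * (bandNormalCoeff μ θ * bandFermiRadius μ θ)) :=
          mul_le_mul_of_nonneg_left hρW hu.le
      _ = Real.sqrt 2 * (bandNormalCoeff μ θ * bandFermiRadius μ θ ^ 2) := by ring
  · rw [← abs_of_pos (by positivity : 0 < bandNormalCoeff μ θ * bandFermiRadius μ θ ^ 2), ← abs_mul, ← hW, hsol,
      abs_neg]
    have e1 : |bandX μ θ * (Real.cos (bandX μ θ) * bandVX μ θ ^ 2 + Real.cos (bandY μ θ) * bandVY μ θ ^ 2)| ≤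
        bandFermiRadius μ θ * umklappRadius μ ^ 2 := by
      rw [abs_mul, abs_of_pos hH]; exact mul_le_mul hx hHK hH.le hu.le
    have e2 : |2 * bandFermiRadius μ θ * bandFermiRadiusDeriv μ θ * Real.sin (bandY μ θ)| ≤
        2 * bandFermiRadius μ θ ^ 2 * Real.sqrt (Real.sin (bandX μ θ) ^ 2 + Real.sin (bandY μ θ) ^ 2) := by
      rw [abs_mul, abs_mul, abs_mul, abs_of_pos hu, abs_of_pos (by norm_num : (0:ℝ) < 2)]
      have := mul_le_mul hud hsy (abs_nonneg _) hu.le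
      nlinarith
    exact (abs_add_le _ _).trans (by linarith)

/-- **Acceleration envelope** for `y''`: `|y''| ≤ √2 (K_μ²/s_μ + 2 K_μ)`. [folklore] -/
theorem klfs_abs_bandAY_le (θ : ℝ) :
    |bandAY μ θ| ≤ Real.sqrt 2 * (umklappRadius μ ^ 2 / (Real.sqrt (-μ * (4 + μ)) / 2) + 2 * umklappRadius μ) := by
  have hu := bandFermiRadius_pos hμ₁ hμ₂ θ
  have hc := bandNormalCoeff_pos hμ₁ hμ₂ θ
  have hH := bandHess_pos hμ₁ hμ₂ θ
  have hHK := klfs_hess_le_umklappRadius_sq hμ₁ hμ₂ θ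
  have huK := klfs_bandFermiRadius_le_umklappRadius hμ₁ hμ₂ θ
  have hud := klfs_abs_radiusDeriv_le hμ₁ hμ₂ θ
  have hW := klfs_W_eq hμ₁ hμ₂ θ
  have hsol := klfs_W_mul_bandAY hμ₁ hμ₂ θ
  have hs0 : 0 < Real.sqrt (-μ * (4 + μ)) / 2 := by
    have : 0 < -μ * (4 + μ) := by nlinarith
    positivity
  have hρs := klfs_levelSin_le_rho hμ₁ hμ₂ θ
  have hρ0 : 0 < Real.sqrt (Real.sin (bandX μ θ) ^ 2 + Real.sin (bandY μ θ) ^ 2) := hs0.trans_le hρs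
  have hρW := klfs_rho_le_sqrt_two_mul_coeff_mul_radius hμ₁ hμ₂ θ
  have hy : |bandY μ θ| ≤ bandFermiRadius μ θ := by
    rw [bandY, abs_mul, abs_of_pos hu]
    exact mul_le_of_le_one_right hu.le (Real.abs_sin_le_one θ)
  have hsx : |Real.sin (bandX μ θ)| ≤ Real.sqrt (Real.sin (bandX μ θ) ^ 2 + Real.sin (bandY μ θ) ^ 2) := by
    rw [← Real.sqrt_sq_eq_abs]; exact Real.sqrt_le_sqrt (by nlinarith [sq_nonneg (Real.sin (bandY μ θ))])
  refine klfs_accel_aux hu hρ0 hs0 hρs huK ?_ ?_ (W := bandNormalCoeff μ θ * bandFermiRadius μ θ ^ 2)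
  · calc bandFermiRadius μ θ * Real.sqrt (Real.sin (bandX μ θ) ^ 2 + Real.sin (bandY μ θ) ^ 2)
        ≤ bandFermiRadius μ θ * (Real.sqrt 2 * (bandNormalCoeff μ θ * bandFermiRadius μ θ)) :=
          mul_le_mul_of_nonneg_left hρW hu.le
      _ = Real.sqrt 2 * (bandNormalCoeff μ θ * bandFermiRadius μ θ ^ 2) := by ring
  · rw [← abs_of_pos (by positivity : 0 < bandNormalCoeff μ θ * bandFermiRadius μ θ ^ 2), ← abs_mul, ← hW, hsol]
    have e1 : |bandY μ θ * (Real.cos (bandX μ θ) * bandVX μ θ ^ 2 + Real.cos (bandY μ θ) * bandVY μ θ ^ 2)| ≤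
        bandFermiRadius μ θ * umklappRadius μ ^ 2 := by
      rw [abs_mul, abs_of_pos hH]; exact mul_le_mul hy hHK hH.le hu.le
    have e2 : |2 * bandFermiRadius μ θ * bandFermiRadiusDeriv μ θ * Real.sin (bandX μ θ)| ≤
        2 * bandFermiRadius μ θ ^ 2 * Real.sqrt (Real.sin (bandX μ θ) ^ 2 + Real.sin (bandY μ θ) ^ 2) := by
      rw [abs_mul, abs_mul, abs_mul, abs_of_pos hu, abs_of_pos (by norm_num : (0:ℝ) < 2)]
      have := mul_le_mul hud hsx (abs_nonneg _) hu.le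
      nlinarith
    exact (abs_sub _ _).trans (by linarith)

/-- **Gauss-map rate from below: `α' ≥ κ_min(μ) · u`**, `κ_min(μ) = -μ/√(32 - 2μ²)` the nodal curvature:
`α' = (x'y'' - y'x'')/(x'² + y'²) = κ · √(x'² + y'²) ≥ κ_min · u`. Attained at the nodes. [folklore] -/
theorem klfs_bandNormalAngleDeriv_ge (θ : ℝ) :
    -μ / Real.sqrt (32 - 2 * μ ^ 2) * bandFermiRadius μ θ ≤ bandNormalAngleDeriv μ θ := by
  have hu := bandFermiRadius_pos hμ₁ hμ₂ θ
  have hκ := (klfs_polarCurvature_mem_Icc hμ₁ hμ₂ θ).1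
  have hκ0 := klfs_curvature_lower_pos hμ₁ hμ₂
  have hVpos := bandVX_sq_add_bandVY_sq_pos hμ₁ hμ₂ θ
  have hV := bandVX_sq_add_bandVY_sq (μ := μ) θ
  have hsV : 0 < Real.sqrt (bandVX μ θ ^ 2 + bandVY μ θ ^ 2) := Real.sqrt_pos.2 hVpos
  have hα : bandNormalAngleDeriv μ θ =
      (bandVX μ θ * bandAY μ θ - bandVY μ θ * bandAX μ θ) / (bandVX μ θ ^ 2 + bandVY μ θ ^ 2) := by
    rw [bandNormalAngleDeriv, bandCross_eq_polar, hV]; ring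
  rw [hα, le_div_iff₀ hVpos]
  rw [le_div_iff₀ (mul_pos hVpos hsV)] at hκ
  have huV : bandFermiRadius μ θ ≤ Real.sqrt (bandVX μ θ ^ 2 + bandVY μ θ ^ 2) := by
    rw [Real.le_sqrt hu.le hVpos.le, hV]; nlinarith [sq_nonneg (bandFermiRadiusDeriv μ θ)]
  calc -μ / Real.sqrt (32 - 2 * μ ^ 2) * bandFermiRadius μ θ * (bandVX μ θ ^ 2 + bandVY μ θ ^ 2)
      ≤ -μ / Real.sqrt (32 - 2 * μ ^ 2) * Real.sqrt (bandVX μ θ ^ 2 + bandVY μ θ ^ 2) *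
          (bandVX μ θ ^ 2 + bandVY μ θ ^ 2) :=
        mul_le_mul_of_nonneg_right (mul_le_mul_of_nonneg_left huV hκ0.le) hVpos.le
    _ = -μ / Real.sqrt (32 - 2 * μ ^ 2) *
          ((bandVX μ θ ^ 2 + bandVY μ θ ^ 2) * Real.sqrt (bandVX μ θ ^ 2 + bandVY μ θ ^ 2)) := by ring
    _ ≤ _ := hκ

/-- **Sharp Gauss-map rate `α' ≥ κ_min(μ) · √2 · d_μ`** — the nodal value `κ_node · |p'|_node`. [folklore] -/
theorem klfs_bandNormalAngleDeriv_ge_node (θ : ℝ) :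
    -μ / Real.sqrt (32 - 2 * μ ^ 2) * (Real.sqrt 2 * Real.arccos (-μ / 4)) ≤ bandNormalAngleDeriv μ θ :=
  (mul_le_mul_of_nonneg_left (klfs_sqrt_two_mul_arccos_le_bandFermiRadius hμ₁ hμ₂ θ)
    (klfs_curvature_lower_pos hμ₁ hμ₂).le).trans (klfs_bandNormalAngleDeriv_ge hμ₁ hμ₂ θ)

end Level

end Summit.HubbardSuperconductivity.HubbardSuperconductivity.Theorems

end
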